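import Summits.Ventures.Crystal3D.Theorems.StickyWulffConstantCoaxialWallLawInPlaneRunEndsPred
import HarnessLib

/-!
# Located in-plane run ends with predecessor, DISJOINT grains: the full flux (thinning trick over `…InPlaneRunEnds`)

HONEST FRAMING. Part of the venture `Summits/Ventures/Crystal3D` (cell `crystal3d-full`), helper
`--supports` the crux `CoaxialWallLaw` (stmt-Ventures-19481, `route-Ventures-StickyWulffConstant`),
REGISTERED line `WallLedgerF` (planner cf-p1 gen 16), open stub `stub_coaxialTwoSlabAdhesion`.
RUNG CREDIT ONLY; F-C1 not moved.  `…InPlaneRunEndsPred` exported the predecessor for the UNIFIED co-axial count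
(two thirds of the flux, valid for twins and translations alike).  For DISJOINT grains (`Λ₁ ∩ Λ₂ = ∅`: translation
pairs, non-CSL twins, and every HEIGHT-INCOMMENSURATE co-axial pair — the (F-γ) case of the planner's ledger) the
full flux is available (`…InPlaneRunEnds.card_inPlane_runEnds_ge_of_disjoint`), and then ONE grain along ONE class
already carries `√2·max|⟪Lvᵢ,e₃⟫| ≥ (√6/2) sin θ`, enough for `c₁ = √6/4 > ½` from a local law at grain 1's ends
alone (`…CoaxialWallLawEndLawAssemblyOneGrain`).  Same thinning trick as in `…InPlaneRunEndsPred`: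

* **`card_inPlane_runEndsPred_ge_of_disjoint`** — bottom grain, `Λ₁ ∩ Λ₂ = ∅`, non-descending slot `d = A₁ u` that is a
  period of `Λ₂`: `#{e ∈ X ∩ Λ₁ : e + d ∉ X, e − d ∈ X, −R₀−2 ≤ e₂ ≤ h+R₀+2} ≥ √2|⟪d,e₃⟫|πρ² − (12√2π + 120R₀)ρ`.

WHAT THIS IS NOT: no deficiency is claimed here; the top-grain mirror is not typed (append when needed); F-C1 not moved.
-/

noncomputable section

namespace Summit.Ventures.Crystal3D.Theorems

open Summit.Ventures.Crystal3D Finset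
open Literature.MathematicalPhysics.StatisticalMechanics (fccStacking)
open scoped InnerProductSpace

open scoped Classical in
/-- **Located in-plane run ends of the bottom grain WITH PREDECESSOR, disjoint grains (full flux).**  See the
module docstring. -/
theorem card_inPlane_runEndsPred_ge_of_disjoint
    (A₁ : EuclideanSpace ℝ (Fin 3) ≃ₗᵢ[ℝ] EuclideanSpace ℝ (Fin 3)) (t₁ : EuclideanSpace ℝ (Fin 3))
    (A₂ : EuclideanSpace ℝ (Fin 3) ≃ₗᵢ[ℝ] EuclideanSpace ℝ (Fin 3)) (t₂ : EuclideanSpace ℝ (Fin 3))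
    (X P₁ P₂ : Finset (EuclideanSpace ℝ (Fin 3))) (R₀ h ρ : ℝ) (hR₀ : 10 ≤ R₀) (hρ : R₀ ≤ ρ)
    (hX : ∀ p ∈ X, ∀ q ∈ X, p ≠ q → 1 ≤ dist p q)
    (hcell : ∀ p ∈ X, -(2 * R₀) ≤ p 2 ∧ p 2 ≤ h + 2 * R₀ ∧ p 0 ^ 2 + p 1 ^ 2 ≤ ρ ^ 2)
    (hP₁X : P₁ ⊆ X) (hP₂X : P₂ ⊆ X)
    (hP₁ : ∀ p, p ∈ P₁ ↔ (p ∈ (fun q => A₁ q + t₁) '' fccStacking 1 (Real.sqrt (2 / 3)) ∧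
      -(2 * R₀) ≤ p 2 ∧ p 2 ≤ -R₀ ∧ p 0 ^ 2 + p 1 ^ 2 ≤ ρ ^ 2))
    (hP₂ : ∀ p, p ∈ P₂ ↔ (p ∈ (fun q => A₂ q + t₂) '' fccStacking 1 (Real.sqrt (2 / 3)) ∧
      h + R₀ ≤ p 2 ∧ p 2 ≤ h + 2 * R₀ ∧ p 0 ^ 2 + p 1 ^ 2 ≤ ρ ^ 2))
    (hdisj : ∀ p ∈ (fun q => A₁ q + t₁) '' fccStacking 1 (Real.sqrt (2 / 3)),
      p ∉ (fun q => A₂ q + t₂) '' fccStacking 1 (Real.sqrt (2 / 3)))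
    {u : EuclideanSpace ℝ (Fin 3)} (hu : u ∈ fccSlots)
    (hup : 0 ≤ ⟪A₁ u, EuclideanSpace.single (2 : Fin 3) (1 : ℝ)⟫_ℝ)
    (hinv₂ : ∀ x, x ∈ (fun q => A₂ q + t₂) '' fccStacking 1 (Real.sqrt (2 / 3)) →
      x + A₁ u ∈ (fun q => A₂ q + t₂) '' fccStacking 1 (Real.sqrt (2 / 3)) ∧
      x - A₁ u ∈ (fun q => A₂ q + t₂) '' fccStacking 1 (Real.sqrt (2 / 3))) :
    Real.sqrt 2 * |⟪A₁ u, EuclideanSpace.single (2 : Fin 3) (1 : ℝ)⟫_ℝ| * Real.pi * ρ ^ 2 -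
        (12 * Real.sqrt 2 * Real.pi + 120 * R₀) * ρ ≤
      ((X.filter fun e => e ∈ (fun q => A₁ q + t₁) '' fccStacking 1 (Real.sqrt (2 / 3)) ∧
        e + A₁ u ∉ X ∧ e - A₁ u ∈ X ∧ -R₀ - 2 ≤ e 2 ∧ e 2 ≤ h + R₀ + 2).card : ℝ) := by
  set e₃ : EuclideanSpace ℝ (Fin 3) := EuclideanSpace.single (2 : Fin 3) (1 : ℝ) with he₃
  set Λ₁ := (fun q => A₁ q + t₁) '' fccStacking 1 (Real.sqrt (2 / 3)) with hΛ₁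
  set Λ₂ := (fun q => A₂ q + t₂) '' fccStacking 1 (Real.sqrt (2 / 3)) with hΛ₂
  set d : EuclideanSpace ℝ (Fin 3) := A₁ u with hd
  have hρ2 : (2 : ℝ) ≤ ρ := by linarith
  have hρ0 : (0 : ℝ) ≤ ρ := by linarith
  have huΛ : u ∈ fccStacking 1 (Real.sqrt (2 / 3)) := mem_fcc_of_mem_fccSlots hu
  have hd1 : ‖d‖ = 1 := by rw [hd, LinearIsometryEquiv.norm_map, norm_eq_one_of_mem_fccSlots hu]
  have hd2 : d 2 = ⟪A₁ u, e₃⟫_ℝ := apply_two_eq_inner_e₃ _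
  set a : ℝ := |⟪A₁ u, e₃⟫_ℝ| with ha
  have ha0 : 0 ≤ a := abs_nonneg _
  have ha1 : a ≤ 1 := abs_inner_slot_le_one A₁ hu
  have hd2le : d 2 ≤ 1 := by rw [hd2]; exact (le_abs_self _).trans ha1
  have hd2nn : 0 ≤ d 2 := by rw [hd2]; exact hup
  -- the thinned filling
  set X' : Finset (EuclideanSpace ℝ (Fin 3)) := X.filter fun x => x - d ∈ X ∨ x ∈ P₁ ∨ x ∈ P₂ with hX'
  have hX'X : X' ⊆ X := filter_subset _ _
  have hX'sep : ∀ p ∈ X', ∀ q ∈ X', p ≠ q → 1 ≤ dist p q :=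
    fun p hp q hq hpq => hX p (hX'X hp) q (hX'X hq) hpq
  have hcell' : ∀ p ∈ X', -(2 * R₀) ≤ p 2 ∧ p 2 ≤ h + 2 * R₀ ∧ p 0 ^ 2 + p 1 ^ 2 ≤ ρ ^ 2 :=
    fun p hp => hcell p (hX'X hp)
  have hP₁X' : P₁ ⊆ X' := fun p hp => mem_filter.2 ⟨hP₁X hp, Or.inr (Or.inl hp)⟩
  have hP₂X' : P₂ ⊆ X' := fun p hp => mem_filter.2 ⟨hP₂X hp, Or.inr (Or.inr hp)⟩
  have hbase := card_inPlane_runEnds_ge_of_disjoint A₁ t₁ A₂ t₂ X' P₁ P₂ R₀ h ρ (by linarith) hρ hX'sep hcell'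
    hP₁X' hP₂X' hP₁ hP₂ hdisj hu hup hinv₂
  -- ends of the thinned filling are ends of `X` with predecessor, up to the lower rim shell
  set ENDS := X.filter fun e => e ∈ Λ₁ ∧ e + d ∉ X ∧ e - d ∈ X ∧ -R₀ - 2 ≤ e 2 ∧ e 2 ≤ h + R₀ + 2
    with hENDS
  set RIM := X.filter fun x => -(2 * R₀) ≤ x 2 ∧ x 2 ≤ -R₀ ∧ (ρ - 1) ^ 2 < x 0 ^ 2 + x 1 ^ 2 ∧
    x 0 ^ 2 + x 1 ^ 2 ≤ ρ ^ 2 with hRIM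
  have hsplit : (X'.filter fun e => e ∈ Λ₁ ∧ e ∉ Λ₂ ∧ e + d ∉ X' ∧ -R₀ - 2 ≤ e 2 ∧ e 2 ≤ h + R₀ + 2) ⊆
      ENDS ∪ RIM := by
    intro e he
    rw [mem_filter] at he
    obtain ⟨heX', heΛ₁, heΛ₂, hed, hlo, hhi⟩ := he
    have heX : e ∈ X := hX'X heX'
    have hedX : e + d ∉ X := by
      intro h'
      exact hed (mem_filter.2 ⟨h', Or.inl (by rw [add_sub_cancel_right]; exact heX)⟩)
    rcases (mem_filter.1 heX').2 with hpred | heP₁ | heP₂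
    · exact mem_union_left _ (mem_filter.2 ⟨heX, heΛ₁, hedX, hpred, hlo, hhi⟩)
    · obtain ⟨-, he1, he2, helat⟩ := (hP₁ e).1 heP₁
      by_cases hr : e 0 ^ 2 + e 1 ^ 2 ≤ (ρ - 1) ^ 2
      · refine mem_union_left _ (mem_filter.2 ⟨heX, heΛ₁, hedX, ?_, hlo, hhi⟩)
        have hlat' : (e - d) 0 ^ 2 + (e - d) 1 ^ 2 ≤ ρ ^ 2 := by
          have := lateral_sq_le_of_dist_le_one (y := e - d) (q := e) (r := ρ - 1) (by linarith) hr
            (by rw [dist_eq_norm, sub_sub_cancel_left, norm_neg, hd1])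
          rwa [sub_add_cancel] at this
        have h2' : (e - d) 2 = e 2 - d 2 := by simp
        have hmem : e - d ∈ Λ₁ := movedFcc_sub_site_mem A₁ t₁ heΛ₁ huΛ
        exact hP₁X ((hP₁ _).2 ⟨hmem, by rw [h2']; linarith, by rw [h2']; linarith, hlat'⟩)
      · push Not at hr
        exact mem_union_right _ (mem_filter.2 ⟨heX, he1, he2, hr, helat⟩)
    · exact absurd ((hP₂ e).1 heP₂).1 heΛ₂
  have hRIM_le : (RIM.card : ℝ) ≤ 6 * (R₀ + 2) * (6 * ρ - 3) := by
    have h1 := card_rim_window_le X (-(2 * R₀)) (-R₀) ρ (by linarith) hρ2 hX RIM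
      (filter_subset _ _) (fun p hp => (mem_filter.1 hp).2)
    have e : -R₀ - -(2 * R₀) + 2 = R₀ + 2 := by ring
    rwa [e] at h1
  have hcard : (X'.filter fun e => e ∈ Λ₁ ∧ e ∉ Λ₂ ∧ e + d ∉ X' ∧ -R₀ - 2 ≤ e 2 ∧ e 2 ≤ h + R₀ + 2).card ≤
      ENDS.card + RIM.card := (card_le_card hsplit).trans (card_union_le _ _)
  have hcard' : (((X'.filter fun e => e ∈ Λ₁ ∧ e ∉ Λ₂ ∧ e + d ∉ X' ∧ -R₀ - 2 ≤ e 2 ∧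
      e 2 ≤ h + R₀ + 2).card : ℕ) : ℝ) ≤ (ENDS.card : ℝ) + (RIM.card : ℝ) := by exact_mod_cast hcard
  have hrim : 6 * (R₀ + 2) * (6 * ρ - 3) ≤ 48 * R₀ * ρ := by nlinarith
  -- linearise the quadratic loss terms
  set M : ℝ := Real.sqrt 2 * Real.pi with hM
  have hM0 : 0 ≤ M := by positivity
  have hkey : Real.sqrt 2 * a * Real.pi * ρ ^ 2 - (12 * Real.sqrt 2 * Real.pi + 120 * R₀) * ρ ≤
      Real.sqrt 2 * a * Real.pi * (ρ - 1) ^ 2 - 10 * Real.sqrt 2 * Real.pi * (ρ - 1) - 72 * R₀ * ρ -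
        48 * R₀ * ρ := by
    have e1 : Real.sqrt 2 * a * Real.pi * (ρ - 1) ^ 2 - 10 * Real.sqrt 2 * Real.pi * (ρ - 1) - 72 * R₀ * ρ -
        48 * R₀ * ρ - (Real.sqrt 2 * a * Real.pi * ρ ^ 2 - (12 * Real.sqrt 2 * Real.pi + 120 * R₀) * ρ) =
        M * a * (1 - 2 * ρ) + 2 * M * ρ + 10 * M := by rw [hM]; ring
    have hprod : 0 ≤ M * ((2 * ρ - 1) * (1 - a)) :=
      mul_nonneg hM0 (mul_nonneg (by linarith) (by linarith))
    have h1 : 0 ≤ M * a * (1 - 2 * ρ) + 2 * M * ρ + 10 * M := by nlinarith [hprod, hM0]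
    linarith
  linarith

end Summit.Ventures.Crystal3D.Theorems

end
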